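import Summits.AnomalousDissipation.AnomalousDissipation.Theorems.SolenoidalFractalHomogenisationLagrangianStepLossCurrency
import Mathlib.Algebra.QuadraticDiscriminant
import Mathlib.Analysis.InnerProductSpace.Projection.Basic
import HarnessLib

/-!
# K1L_D (stmt-AnomalousDissipation-27980): LOSS CURRENCY — the loss BILINEAR FORM of a contraction (Cauchy–Schwarz for the cross term) and
# tests seen through a closed subspace containing the range (helper; prover ad-k1loc-p3 g11, `--supports 27980 --as helper`; pure Hilbert-space
# algebra for the (ℓ3-A) distorted blocks, memo `HOME/ad-k1loc-p3/FSG-SPEC-p3g11.md` v2 §6)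

For a contraction `T` of a real Hilbert space `H` the polarisation of the loss `q_T(a) = ‖a‖² − ‖T a‖²` is the symmetric bilinear form
`L_T(a,b) = ⟪a,b⟫ − ⟪T a, T b⟫`; since `q_T ≥ 0` it is positive semidefinite, hence
* **`abs_inner_sub_inner_map_le`** — `|⟪a,b⟫ − ⟪T a, T b⟫| ≤ √q_T(a)·√q_T(b)` (discriminant of `s ↦ q_T(a + s b)`), and the adjoint twin
  **`abs_inner_sub_inner_adjoint_le`** — `|⟪a,b⟫ − ⟪T†a, T†b⟫| ≤ √q*_T(a)·√q*_T(b)`: the CROSS TERMS of the 2×2 block bookkeeping are ALWAYS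
  in loss currency with constant `1` (the distorted assembly's (M_θ) asks for a constant `< 1`; this is the free half);
* `loss_add_eq` — `q_T(a+b) = q_T(a) + q_T(b) + 2 L_T(a,b)`.
For a closed subspace `K` (with orthogonal projection `P`) containing the RANGE of `T` (the `G(t)`-solenoidal classes of a distorted propagator):
* `adjoint_eq_adjoint_starProjection` — `T† ζ = T† (P ζ)`; `inner_eq_inner_starProjection_of_mem` — `⟪v, ζ⟫ = ⟪v, P ζ⟫` for `v ∈ K`;
* **`lossAdj_starProjection_le`** — `q*_T(P ζ) ≤ q*_T(ζ)`: replacing a test by its projection onto the range class never increases the adjoint loss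
  (so a block may be PROVED for admissible — projected / frame-corrected — tests and TRANSFERRED to arbitrary tests of the same class at the assembly).
`sorry`-free; NOT a proof of any block, of (M_θ), of K1L_D or of AD; rung F-D1.A0.
-/

set_option linter.dupNamespace false

noncomputable section

namespace Summit.AnomalousDissipation.AnomalousDissipation.Theorems.SolenoidalFractalHomogenisation.LagrangianStep.LossCurrency

open scoped InnerProductSpace

variable {H : Type*} [NormedAddCommGroup H] [InnerProductSpace ℝ H] [CompleteSpace H]

/-! ## §1 The loss bilinear form -/

omit [CompleteSpace H] in
/-- Polarisation: `q_T(a + b) = q_T(a) + q_T(b) + 2(⟪a,b⟫ − ⟪T a, T b⟫)`. -/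
theorem loss_add_eq (T : H →L[ℝ] H) (a b : H) :
    ‖a + b‖ ^ 2 - ‖T (a + b)‖ ^ 2 = (‖a‖ ^ 2 - ‖T a‖ ^ 2) + (‖b‖ ^ 2 - ‖T b‖ ^ 2) + 2 * (⟪a, b⟫_ℝ - ⟪T a, T b⟫_ℝ) := by
  rw [map_add, norm_add_sq_real, norm_add_sq_real]
  ring

omit [CompleteSpace H] in
/-- Polarisation with a real parameter: `q_T(a + s•b) = q_T(a) + 2s(⟪a,b⟫ − ⟪T a, T b⟫) + s² q_T(b)`. -/
theorem loss_add_smul_eq (T : H →L[ℝ] H) (a b : H) (s : ℝ) :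
    ‖a + s • b‖ ^ 2 - ‖T (a + s • b)‖ ^ 2
      = (‖b‖ ^ 2 - ‖T b‖ ^ 2) * (s * s) + 2 * (⟪a, b⟫_ℝ - ⟪T a, T b⟫_ℝ) * s + (‖a‖ ^ 2 - ‖T a‖ ^ 2) := by
  rw [map_add, map_smul, norm_add_sq_real, norm_add_sq_real, inner_smul_right, inner_smul_right, norm_smul, norm_smul, Real.norm_eq_abs,
    mul_pow, mul_pow, sq_abs]
  ring

omit [CompleteSpace H] in
/-- **Cauchy–Schwarz for the loss form of a contraction**: `|⟪a,b⟫ − ⟪T a, T b⟫| ≤ √(‖a‖² − ‖T a‖²)·√(‖b‖² − ‖T b‖²)`. -/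
theorem abs_inner_sub_inner_map_le {T : H →L[ℝ] H} (hT : ∀ y, ‖T y‖ ≤ ‖y‖) (a b : H) :
    |⟪a, b⟫_ℝ - ⟪T a, T b⟫_ℝ| ≤ Real.sqrt (‖a‖ ^ 2 - ‖T a‖ ^ 2) * Real.sqrt (‖b‖ ^ 2 - ‖T b‖ ^ 2) := by
  set A : ℝ := ‖b‖ ^ 2 - ‖T b‖ ^ 2 with hA
  set B : ℝ := 2 * (⟪a, b⟫_ℝ - ⟪T a, T b⟫_ℝ) with hB
  set C : ℝ := ‖a‖ ^ 2 - ‖T a‖ ^ 2 with hC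
  have hA0 : 0 ≤ A := loss_nonneg hT b
  have hC0 : 0 ≤ C := loss_nonneg hT a
  have hquad : ∀ s : ℝ, 0 ≤ A * (s * s) + B * s + C := fun s => by
    rw [hA, hB, hC, ← loss_add_smul_eq T a b s]; exact loss_nonneg hT _
  have hdisc : B ^ 2 - 4 * A * C ≤ 0 := by
    have h := discrim_le_zero hquad
    rwa [discrim] at h
  have hsq : (⟪a, b⟫_ℝ - ⟪T a, T b⟫_ℝ) ^ 2 ≤ C * A := by rw [hB] at hdisc; nlinarith
  have hL : |⟪a, b⟫_ℝ - ⟪T a, T b⟫_ℝ| = Real.sqrt ((⟪a, b⟫_ℝ - ⟪T a, T b⟫_ℝ) ^ 2) := (Real.sqrt_sq_eq_abs _).symm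
  rw [hL, ← Real.sqrt_mul hC0]
  exact Real.sqrt_le_sqrt hsq

/-- **Cauchy–Schwarz for the ADJOINT loss form**: `|⟪a,b⟫ − ⟪T†a, T†b⟫| ≤ √q*_T(a)·√q*_T(b)` (the adjoint of a contraction is a contraction). -/
theorem abs_inner_sub_inner_adjoint_le {T : H →L[ℝ] H} (hT : ∀ y, ‖T y‖ ≤ ‖y‖) (a b : H) :
    |⟪a, b⟫_ℝ - ⟪ContinuousLinearMap.adjoint T a, ContinuousLinearMap.adjoint T b⟫_ℝ|
      ≤ Real.sqrt (‖a‖ ^ 2 - ‖ContinuousLinearMap.adjoint T a‖ ^ 2) * Real.sqrt (‖b‖ ^ 2 - ‖ContinuousLinearMap.adjoint T b‖ ^ 2) :=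
  abs_inner_sub_inner_map_le (norm_adjoint_le hT) a b

/-- The 2×2 bookkeeping form: `q*_T(a + b) ≥ q*_T(a) + q*_T(b) − 2√q*_T(a)√q*_T(b)` for ANY two tests (no orthogonality), and the upper twin. -/
theorem lossAdj_add_ge {T : H →L[ℝ] H} (hT : ∀ y, ‖T y‖ ≤ ‖y‖) (a b : H) :
    (‖a‖ ^ 2 - ‖ContinuousLinearMap.adjoint T a‖ ^ 2) + (‖b‖ ^ 2 - ‖ContinuousLinearMap.adjoint T b‖ ^ 2)
        - 2 * (Real.sqrt (‖a‖ ^ 2 - ‖ContinuousLinearMap.adjoint T a‖ ^ 2) * Real.sqrt (‖b‖ ^ 2 - ‖ContinuousLinearMap.adjoint T b‖ ^ 2))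
      ≤ ‖a + b‖ ^ 2 - ‖ContinuousLinearMap.adjoint T (a + b)‖ ^ 2 := by
  have h := abs_inner_sub_inner_adjoint_le hT a b
  rw [loss_add_eq]
  have := neg_abs_le (⟪a, b⟫_ℝ - ⟪ContinuousLinearMap.adjoint T a, ContinuousLinearMap.adjoint T b⟫_ℝ)
  linarith

/-! ## §2 Tests seen through a closed subspace containing the range -/

/-- If the range of `T` lies in the closed subspace `K`, the adjoint only sees the projection of the test onto `K`: `T† ζ = T† (P ζ)`. -/
theorem adjoint_eq_adjoint_starProjection {T : H →L[ℝ] H} (K : Submodule ℝ H) [K.HasOrthogonalProjection] (hT : ∀ y, T y ∈ K) (ζ : H) :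
    ContinuousLinearMap.adjoint T ζ = ContinuousLinearMap.adjoint T (K.starProjection ζ) := by
  rw [← sub_eq_zero, ← map_sub, ← inner_self_eq_zero (𝕜 := ℝ), ContinuousLinearMap.adjoint_inner_left]
  exact K.starProjection_inner_eq_zero ζ _ (hT _)

omit [CompleteSpace H] in
/-- Members of `K` only see the projection of a test onto `K`: `⟪v, ζ⟫ = ⟪v, P ζ⟫` for `v ∈ K`. -/
theorem inner_eq_inner_starProjection_of_mem (K : Submodule ℝ H) [K.HasOrthogonalProjection] {v : H} (hv : v ∈ K) (ζ : H) :
    ⟪v, ζ⟫_ℝ = ⟪v, K.starProjection ζ⟫_ℝ := by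
  have h0 : ⟪ζ - K.starProjection ζ, v⟫_ℝ = 0 := K.starProjection_inner_eq_zero ζ v hv
  have h1 : ⟪v, ζ - K.starProjection ζ⟫_ℝ = 0 := by rw [real_inner_comm]; exact h0
  rwa [inner_sub_right, sub_eq_zero] at h1

/-- **Projecting a test onto a closed subspace containing the range never increases the adjoint loss**: `q*_T(P ζ) ≤ q*_T(ζ)`. -/
theorem lossAdj_starProjection_le {T : H →L[ℝ] H} (K : Submodule ℝ H) [K.HasOrthogonalProjection] (hT : ∀ y, T y ∈ K) (ζ : H) :
    ‖K.starProjection ζ‖ ^ 2 - ‖ContinuousLinearMap.adjoint T (K.starProjection ζ)‖ ^ 2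
      ≤ ‖ζ‖ ^ 2 - ‖ContinuousLinearMap.adjoint T ζ‖ ^ 2 := by
  rw [← adjoint_eq_adjoint_starProjection K hT ζ]
  have h := K.norm_starProjection_apply_le ζ
  nlinarith [norm_nonneg (K.starProjection ζ), norm_nonneg ζ]

/-- The pairing of a range-class vector against a test and its adjoint loss both pass to the projected test: for `v ∈ K`,
`|⟪v, ζ⟫| ≤ η·A·√q*_T(P ζ)` implies `|⟪v, ζ⟫| ≤ η·A·√q*_T(ζ)` (`η, A ≥ 0`). -/
theorem pairing_le_of_pairing_starProjection_le {T : H →L[ℝ] H} (K : Submodule ℝ H) [K.HasOrthogonalProjection] (hT : ∀ y, T y ∈ K)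
    {v : H} (hv : v ∈ K) (ζ : H) {η A : ℝ} (hη : 0 ≤ η) (hA : 0 ≤ A)
    (h : |⟪v, K.starProjection ζ⟫_ℝ| ≤ η * A * Real.sqrt (‖K.starProjection ζ‖ ^ 2 - ‖ContinuousLinearMap.adjoint T (K.starProjection ζ)‖ ^ 2)) :
    |⟪v, ζ⟫_ℝ| ≤ η * A * Real.sqrt (‖ζ‖ ^ 2 - ‖ContinuousLinearMap.adjoint T ζ‖ ^ 2) := by
  rw [inner_eq_inner_starProjection_of_mem K hv ζ]
  exact h.trans (mul_le_mul_of_nonneg_left (Real.sqrt_le_sqrt (lossAdj_starProjection_le K hT ζ)) (mul_nonneg hη hA))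

end Summit.AnomalousDissipation.AnomalousDissipation.Theorems.SolenoidalFractalHomogenisation.LagrangianStep.LossCurrency

end
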